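import Summits.ABC.IUTFork.Joshi.WittPrimitiveElementsStandardPoint
import Mathlib.RingTheory.WittVector.Complete
import Mathlib.RingTheory.Valuation.ValuationRing
import Mathlib.Algebra.Ring.GeomSum
import HarnessLib

/-!
# [J-IIp] Prop. 6.2.1 (2) — the PRIMALITY of `𝔭_j = ([a^{j²}] − p) ⊂ W(𝒪_F)` — PROVED for every `a` and every `j`:
# `W(𝒪)/([a] − p)` has no zero-divisors for `𝒪` a perfect valuation domain of characteristic `p`
# (proof-only companion of `Joshi/WittPrimitiveElements.lean`, block E, seat abc-iut-E-t47)

Proof-only companion (abc-iut cell, block E «type Joshi's construction, test vs S», rung LADDER-ABC:A2.E; seat abc-iut-E-t47,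
[J-IIp] local / Witt lineage; RE-SEAT POLICY «one companion for what is genuinely missing») of abc-iut-E-t62's
`Joshi/WittPrimitiveElements.lean` (p434913) and `Joshi/WittPrimitiveElementsStandardPoint.lean` (p442499), both typing K. Joshi,
*Construction of Arithmetic Teichmüller Spaces II: Proof of a local prototype of Mochizuki's Corollary 3.12*, arXiv:2303.01662v3
= [J-IIp] (`paper:arxiv-2303.01662`; render `HOME/lit/renders/Joshi-arxiv-2303.01662/pNNNN.txt`, «p. N l. M» = line M of page N).

THE SENTENCE. Prop. 6.2.1 (2), p. 14 l. 57–59: «Each of these elements generates a principal prime ideal `𝔭_j = ([a^{j²}] − p) ⊂ W(𝒪_F)`»,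
for «`F` an algebraically closed, perfectoid field of characteristic `p > 0` with its given valuation `|−|_F`» (p. 14 l. 47–48) and
`0 ≠ a ∈ 𝔪_F` (p. 14 l. 53); printed proof p. 15 l. 8–14: «By [Fargues and Fontaine, 2018, Lemma 2.2.14] … the ideal `𝔭_j = ([a^{j²}] − p)`
… is a principal prime ideal of `W(𝒪_F)` generated by a primitive element of degree one». The typer's file left this clause as the
claim-`Prop` `Witt.Prop621PrimeClaim p 𝔪 ℓ⋆ := ∀ a ≠ 0, a ∈ 𝔪 → ∀ j, (𝔭_j(a)).IsPrime` because the untilt `W(𝒪_F)/([a] − p)` is not in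
Mathlib; p442499 discharged it on the single Frobenius orbit of `ker θ` (the untilt `ℂ_F` itself, via Fontaine's `θ`).

WHAT IS PROVED HERE (hypothesis-free as to [FF18]; no untilt, no `θ`, no valuation on the quotient is constructed). Let `𝒪` be a
commutative ring of characteristic `p` that is PERFECT (Mathlib `PerfectRing 𝒪 p`), a DOMAIN and a VALUATION RING (Mathlib
`ValuationRing 𝒪`: divisibility is total) — Joshi's `𝒪_F` is all three — and let `0 ≠ a ∈ 𝒪` be a non-unit which is `a`-ADICALLY
HAUSDORFF: `∀ c, (∀ n, aⁿ ∣ c) → c = 0` (automatic for a rank-one valuation, i.e. for every perfectoid `F`). Write `ξ = [a] − p ∈ W(𝒪)`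
(`Witt.teichSubP p a`). Then, over Mathlib's `WittVector p 𝒪`:
1. `Witt.pow_dvd_of_teichSubP_dvd_teichmuller` : `ξ ∣ [c] ⟹ aⁿ ∣ c` for every `n` (zeroth Witt coordinates give `c = a·z₀`, and
   `p`-torsion-freeness of `W(𝒪)` — Mathlib `WittVector.eq_zero_of_p_mul_eq_zero` — gives `ξ ∣ [z₀]`; iterate); hence
   `Witt.eq_zero_of_teichSubP_dvd_teichmuller` : no non-zero Teichmüller representative lies in `(ξ)`.
2. `Witt.p_pow_dvd_of_dvd_teichSubP_mul` : `pⁿ ∣ ξ·w ⟹ pⁿ ∣ w`, and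
   `Witt.teichSubP_dvd_of_forall` : **`(ξ)` is `p`-adically CLOSED** — if `x` is congruent to a multiple of `ξ` modulo `pⁿ` for every
   `n`, then `ξ ∣ x` (the approximating multipliers form a `p`-adic Cauchy sequence; `W(𝒪)` is `p`-adically complete and separated,
   Mathlib `WittVector.isAdicCompleteIdealSpanP`).
3. `Witt.exists_teichmuller_mul_unit_of_not_dvd` : every `x ∉ (ξ)` is congruent mod `ξ` to `[c]·u` with `c ≠ 0` and `u` a UNIT of
   `W(𝒪)` (peel off the largest `pⁿ ≡ [a]ⁿ`; the remaining zeroth coordinate `w₀` does not lie in `(a)`, so — valuation ring —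
   `a = w₀·m` with `m ∈ 𝔪`, and `x ≡ [aⁿ w₀]·(1 + [m]·w′)`, a unit by its zeroth coordinate, E-t62's `Witt.isUnit_of_isUnit_coeff_zero`).
4. **`Witt.isPrime_span_teichSubP` : `([a] − p)` is a PRIME ideal of `W(𝒪)`** (if `x·y ∈ (ξ)` with `x, y ∉ (ξ)` then `[c·c′]·unit ∈ (ξ)`,
   so `c·c′ = 0` by 1., contradicting `c, c′ ≠ 0`), and therefore
5. **`Witt.prop621PrimeClaim_of_valuationRing` : `Witt.Prop621PrimeClaim p 𝔪 ℓ⋆` HOLDS** for every proper ideal `𝔪` all of whose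
   elements are adically Hausdorff — in particular for the maximal ideal of `𝒪_F`, `F` any perfectoid field of characteristic `p`
   (`Witt.prop621PrimeClaim_maximalIdeal`): Joshi's Prop. 6.2.1 (2) in full, for every `a ∈ 𝔪_F ∖ {0}` and every `j = 1, …, ℓ⋆`.
HONEST SCOPE. (i) The hypotheses «perfect», «valuation ring», «`a`-adically Hausdorff» are those of print (`𝒪_F`, rank one); none is
idle: `Witt.not_prop621PrimeClaim_top` (p442499) shows «`a` non-unit» is load-bearing, and without Hausdorffness `[c] ∈ (ξ)` can have
`c ≠ 0` in higher rank. (ii) NOT touched: Lemma 6.2.2 / the [FF18, Cor. 2.2.9] binder `hFF` of `Witt.lem622_of_cor229` (it needs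
`p ∈ ♯(𝒪_F)` in the untilt, i.e. algebraic closedness), the field structure / valuation of the untilt `K_y`, Thm. 6.9.1. (iii) This is
commutative algebra of Witt vectors ([FF18, §2.2] folklore reproved in kernel), not an adjudication: TYPED AS A CANDIDATE (D-0012),
typed ≠ proved ≠ endorsed; **no side is taken** on [IUTchIII] Cor. 3.12, on Joshi's claims or on Mochizuki's report on them; nothing
here bears on S. No `def`, no instance, no notation, no FACT-LIST input, no `Cor312*`/`Thm311*` import (R14). [claim: Joshi2023ATS2Local, status: disputed]
-/

noncomputable section

namespace Summit.ABC.IUTFork.Joshi.Witt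

open WittVector

variable (p : ℕ) [hp : Fact p.Prime] {O : Type*} [CommRing O]

/-! ## 0. Two bookkeeping identities over any commutative ring -/

/-- `[a] = ([a] − p) + p`. [folklore] -/
theorem teichmuller_eq_teichSubP_add (a : O) : teichmuller p a = teichSubP p a + p := by
  rw [teichSubP, sub_add_cancel]

/-- Membership in `(p)ⁿ • ⊤ ⊂ W(𝒪)` is divisibility by `pⁿ`. [folklore] -/
theorem mem_span_p_pow_smul_top_iff (n : ℕ) (z : WittVector p O) :
    z ∈ (Ideal.span {(p : WittVector p O)}) ^ n • (⊤ : Submodule (WittVector p O) (WittVector p O)) ↔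
      (p : WittVector p O) ^ n ∣ z := by
  simp only [smul_eq_mul, Ideal.mul_top, Ideal.span_singleton_pow, Ideal.mem_span_singleton]

variable [CharP O p]

/-! ## 1. Teichmüller representatives modulo `p`, and no non-zero Teichmüller representative in `([a] − p)` -/

section Perfect

variable [PerfectRing O p]

/-- Over a PERFECT ring of characteristic `p`, every Witt vector is its zeroth Teichmüller representative plus a multiple of `p`:
`x = [x₀] + p·y` (Mathlib: `x − [x₀] ∈ (p)` iff its zeroth coordinate vanishes, `WittVector.mem_span_p_iff_coeff_zero_eq_zero`). [folklore] -/
theorem exists_eq_teichmuller_add_p_mul (x : WittVector p O) :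
    ∃ y : WittVector p O, x = teichmuller p (x.coeff 0) + (p : WittVector p O) * y := by
  have h0 : (x - teichmuller p (x.coeff 0)).coeff 0 = 0 := by
    rw [← constantCoeff_apply, map_sub, constantCoeff_apply, constantCoeff_apply, teichmuller_coeff_zero, sub_self]
  obtain ⟨y, hy⟩ := Ideal.mem_span_singleton'.1 ((mem_span_p_iff_coeff_zero_eq_zero _).2 h0)
  exact ⟨y, by rw [mul_comm, hy, add_sub_cancel]⟩

/-- **`([a] − p) ∣ [c] ⟹ aⁿ ∣ c` for every `n`** (`𝒪` perfect of characteristic `p`). Step: from `[c] = ([a] − p)·z`, zeroth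
coordinates give `c = a·z₀`; writing `z = [z₀] + p·z′` and `[c] = [a][z₀]` leaves `p·([z₀] − ([a] − p)·z′) = 0`, so `([a] − p) ∣ [z₀]` by
`p`-torsion-freeness of `W(𝒪)` (Mathlib `WittVector.eq_zero_of_p_mul_eq_zero`), and induction applies to `z₀ = c/a`. [folklore] -/
theorem pow_dvd_of_teichSubP_dvd_teichmuller (a : O) :
    ∀ (n : ℕ) (c : O), teichSubP p a ∣ teichmuller p c → a ^ n ∣ c := by
  intro n
  induction n with
  | zero => intro c _; exact ⟨c, by rw [pow_zero, one_mul]⟩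
  | succ n ih =>
    intro c hc
    obtain ⟨z, hz⟩ := hc
    -- zeroth coordinates: `c = a · z₀`
    have h0 : c = a * z.coeff 0 := by
      have h := congrArg (fun w : WittVector p O => w.coeff 0) hz
      simpa only [teichmuller_coeff_zero, coeff_zero_teichSubP_mul] using h
    obtain ⟨z', hz'⟩ := exists_eq_teichmuller_add_p_mul p z
    have key : (teichmuller p (z.coeff 0) - teichSubP p a * z') * p = 0 := by
      have e1 : teichmuller p c = teichmuller p a * teichmuller p (z.coeff 0) := by
        rw [← map_mul, ← h0]
      rw [hz', e1, teichmuller_eq_teichSubP_add p a] at hz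
      linear_combination hz
    have h1 : teichmuller p (z.coeff 0) = teichSubP p a * z' :=
      sub_eq_zero.1 (eq_zero_of_p_mul_eq_zero _ key)
    have h2 : a ^ n ∣ z.coeff 0 := ih _ ⟨z', h1⟩
    rw [h0, pow_succ']
    exact mul_dvd_mul_left a h2

/-- **No non-zero Teichmüller representative lies in `([a] − p)`** when `a` is adically Hausdorff (`⋂ₙ (aⁿ) = 0`, e.g. `0 ≠ a ∈ 𝔪_F`
for a rank-one valuation). [folklore] -/
theorem eq_zero_of_teichSubP_dvd_teichmuller {a : O} (hH : ∀ c : O, (∀ n : ℕ, a ^ n ∣ c) → c = 0) {c : O}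
    (hc : teichSubP p a ∣ teichmuller p c) : c = 0 :=
  hH c fun n => pow_dvd_of_teichSubP_dvd_teichmuller p a n c hc

/-! ## 2. `([a] − p)` is `p`-adically closed in `W(𝒪)` (`𝒪` a perfect domain, `a ≠ 0`) -/

variable [IsDomain O]

/-- **`pⁿ ∣ ([a] − p)·w ⟹ pⁿ ∣ w`** (`a ≠ 0`, `𝒪` a perfect domain): modulo `p` the product has zeroth coordinate `a·w₀`, so `w₀ = 0`
and `w = p·w′`; cancel one `p` (torsion-freeness) and induct. [folklore] -/
theorem p_pow_dvd_of_dvd_teichSubP_mul {a : O} (ha0 : a ≠ 0) :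
    ∀ (n : ℕ) (w : WittVector p O), (p : WittVector p O) ^ n ∣ teichSubP p a * w → (p : WittVector p O) ^ n ∣ w := by
  intro n
  induction n with
  | zero => intro w _; rw [pow_zero]; exact one_dvd w
  | succ n ih =>
    intro w hw
    have hp1 : (p : WittVector p O) ∣ teichSubP p a * w := (dvd_pow_self _ n.succ_ne_zero).trans hw
    have h0 : w.coeff 0 = 0 := by
      have h := (mem_span_p_iff_coeff_zero_eq_zero _).1 (Ideal.mem_span_singleton.2 hp1)
      rw [coeff_zero_teichSubP_mul] at h
      exact (mul_eq_zero.1 h).resolve_left ha0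
    obtain ⟨w', hw'⟩ := Ideal.mem_span_singleton'.1 ((mem_span_p_iff_coeff_zero_eq_zero w).2 h0)
    obtain ⟨t, ht⟩ := hw
    have key : (teichSubP p a * w' - (p : WittVector p O) ^ n * t) * p = 0 := by
      rw [← hw'] at ht
      linear_combination ht
    have h1 : (p : WittVector p O) ^ n ∣ teichSubP p a * w' :=
      ⟨t, sub_eq_zero.1 (eq_zero_of_p_mul_eq_zero _ key)⟩
    obtain ⟨s, hs⟩ := ih w' h1
    exact ⟨s, by rw [← hw', hs]; ring⟩

/-- **`([a] − p)` is `p`-adically CLOSED in `W(𝒪)`** (`𝒪` a perfect domain of characteristic `p`, `a ≠ 0`): if for every `n` some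
multiple of `[a] − p` is congruent to `x` modulo `pⁿ`, then `([a] − p) ∣ x`. The multipliers `yₙ` are `p`-adically Cauchy
(`p_pow_dvd_of_dvd_teichSubP_mul`), converge in the `p`-adically complete ring `W(𝒪)` (Mathlib `WittVector.isAdicCompleteIdealSpanP`),
and the limit `L` satisfies `x − ([a] − p)·L ∈ ⋂ₙ (pⁿ) = 0`. Equivalently: `W(𝒪)/([a] − p)` is `p`-adically separated. [folklore] -/
theorem teichSubP_dvd_of_forall {a : O} (ha0 : a ≠ 0) {x : WittVector p O}
    (hx : ∀ n : ℕ, ∃ y : WittVector p O, (p : WittVector p O) ^ n ∣ x - teichSubP p a * y) : teichSubP p a ∣ x := by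
  choose y hy using hx
  have hcau : ∀ {m n : ℕ}, m ≤ n → y m ≡ y n
      [SMOD (Ideal.span {(p : WittVector p O)}) ^ m • (⊤ : Submodule (WittVector p O) (WittVector p O))] := by
    intro m n hmn
    rw [SModEq.sub_mem, mem_span_p_pow_smul_top_iff]
    apply p_pow_dvd_of_dvd_teichSubP_mul p ha0
    have e : teichSubP p a * (y m - y n) = (x - teichSubP p a * y n) - (x - teichSubP p a * y m) := by ring
    rw [e]
    exact dvd_sub ((pow_dvd_pow _ hmn).trans (hy n)) (hy m)
  obtain ⟨L, hL⟩ := IsPrecomplete.prec' y hcau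
  refine ⟨L, sub_eq_zero.1 (IsHausdorff.haus' (I := Ideal.span {(p : WittVector p O)}) (x - teichSubP p a * L) fun n => ?_)⟩
  rw [SModEq.zero, mem_span_p_pow_smul_top_iff]
  have e : x - teichSubP p a * L = (x - teichSubP p a * y n) + teichSubP p a * (y n - L) := by ring
  rw [e]
  exact dvd_add (hy n) (dvd_mul_of_dvd_right ((mem_span_p_pow_smul_top_iff p n _).1 (SModEq.sub_mem.1 (hL n))) _)

/-- **Peeling off `pⁿ`**: an `x ∉ ([a] − p)` is `([a] − p)·y + pⁿ·([w₀] + p·w′)` with `a ∤ w₀` for some `n` (take `n + 1` = the least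
level at which NO multiple of `[a] − p` approximates `x`, which exists by closedness; if `a ∣ w₀` then `[w₀] = ([a] − p + p)[w₀/a]`
would give an approximation at level `n + 1`). [folklore] -/
theorem exists_decomp_of_not_dvd {a : O} (ha0 : a ≠ 0) {x : WittVector p O} (hx : ¬ teichSubP p a ∣ x) :
    ∃ (n : ℕ) (y : WittVector p O) (w₀ : O) (w' : WittVector p O),
      x = teichSubP p a * y + (p : WittVector p O) ^ n * (teichmuller p w₀ + (p : WittVector p O) * w') ∧ ¬ a ∣ w₀ := by
  classical
  have hex : ∃ n : ℕ, ¬ ∃ y : WittVector p O, (p : WittVector p O) ^ n ∣ x - teichSubP p a * y := by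
    by_contra h
    push Not at h
    exact hx (teichSubP_dvd_of_forall p ha0 h)
  have hN := Nat.find_spec hex
  have hN0 : Nat.find hex ≠ 0 := by
    intro h0
    rw [h0] at hN
    exact hN ⟨0, by rw [pow_zero]; exact one_dvd _⟩
  obtain ⟨n, hn⟩ : ∃ n : ℕ, Nat.find hex = n + 1 := ⟨Nat.find hex - 1, by omega⟩
  have hn' := Nat.find_min hex (show n < Nat.find hex by omega)
  push Not at hn'
  obtain ⟨y, w, hw⟩ := hn'
  obtain ⟨w', hw'⟩ := exists_eq_teichmuller_add_p_mul p w
  refine ⟨n, y, w.coeff 0, w', by rw [← hw', ← hw]; ring, fun ⟨d, hd⟩ => hN ?_⟩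
  rw [hn]
  refine ⟨y + (p : WittVector p O) ^ n * teichmuller p d, teichmuller p d + w', ?_⟩
  have hx' : x = teichSubP p a * y + (p : WittVector p O) ^ n * w := by rw [← hw]; ring
  have hw2 : w = teichmuller p a * teichmuller p d + (p : WittVector p O) * w' := by rw [← map_mul, ← hd]; exact hw'
  rw [hx', hw2, teichmuller_eq_teichSubP_add p a]
  ring

end Perfect

/-! ## 3. Over a perfect VALUATION domain: residues are Teichmüller representatives times units; `([a] − p)` is prime -/

section Valuation

variable [PerfectRing O p] [IsDomain O] [ValuationRing O]

/-- **Every `x ∉ ([a] − p)` is `≡ [c]·u (mod [a] − p)` with `c ≠ 0` and `u ∈ W(𝒪)ˣ`** (`𝒪` a perfect valuation domain, `a ≠ 0`):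
with `x = ([a] − p)y + pⁿ([w₀] + p w′)`, `a ∤ w₀` (`exists_decomp_of_not_dvd`), totality of divisibility gives `a = w₀·m` with `m` a
NON-unit; modulo `[a] − p` one has `p ≡ [a]`, so `x ≡ [a]ⁿ([w₀] + [a]w′) = [aⁿw₀]·(1 + [m]w′)`, and `1 + [m]w′` is a unit because its
zeroth coordinate `1 + m·w′₀` is (`𝒪` local; E-t62's `Witt.isUnit_of_isUnit_coeff_zero`). [folklore] -/
theorem exists_teichmuller_mul_unit_of_not_dvd {a : O} (ha0 : a ≠ 0) {x : WittVector p O} (hx : ¬ teichSubP p a ∣ x) :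
    ∃ (c : O) (u : WittVector p O), c ≠ 0 ∧ IsUnit u ∧ teichSubP p a ∣ x - teichmuller p c * u := by
  obtain ⟨n, y, w₀, w', hxw, hnd⟩ := exists_decomp_of_not_dvd p ha0 hx
  -- valuation ring: `a = w₀ · m` with `m` a non-unit
  obtain ⟨m, hm, hmu⟩ : ∃ m : O, w₀ * m = a ∧ ¬ IsUnit m := by
    rcases ValuationRing.cond a w₀ with ⟨c, hc | hc⟩
    · exact absurd ⟨c, hc.symm⟩ hnd
    · refine ⟨c, hc, fun hu => hnd ⟨↑hu.unit⁻¹, ?_⟩⟩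
      rw [← hc, mul_assoc, IsUnit.mul_val_inv, mul_one]
  have hw0 : w₀ ≠ 0 := fun h => hnd (h ▸ dvd_zero a)
  refine ⟨a ^ n * w₀, 1 + teichmuller p m * w', mul_ne_zero (pow_ne_zero _ ha0) hw0, ?_, ?_⟩
  · apply isUnit_of_isUnit_coeff_zero p
    rw [← constantCoeff_apply, map_add, map_one, map_mul, constantCoeff_apply, constantCoeff_apply,
      teichmuller_coeff_zero]
    have hmem : -(m * w'.coeff 0) ∈ nonunits O := by
      rw [← IsLocalRing.mem_maximalIdeal]
      exact neg_mem (Ideal.mul_mem_right _ _ ((IsLocalRing.mem_maximalIdeal m).2 hmu))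
    have h1 := IsLocalRing.isUnit_one_sub_self_of_mem_nonunits _ hmem
    rwa [sub_neg_eq_add] at h1
  · subst hm
    have hξ : teichSubP p (w₀ * m) ∣ (p : WittVector p O) - teichmuller p (w₀ * m) :=
      ⟨-1, by rw [teichSubP]; ring⟩
    have d1 := hξ.trans (sub_dvd_pow_sub_pow (p : WittVector p O) (teichmuller p (w₀ * m)) n)
    have d2 := hξ.trans (sub_dvd_pow_sub_pow (p : WittVector p O) (teichmuller p (w₀ * m)) (n + 1))
    have e : x - teichmuller p ((w₀ * m) ^ n * w₀) * (1 + teichmuller p m * w') =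
        teichSubP p (w₀ * m) * y
          + ((p : WittVector p O) ^ n - teichmuller p (w₀ * m) ^ n) * teichmuller p w₀
          + ((p : WittVector p O) ^ (n + 1) - teichmuller p (w₀ * m) ^ (n + 1)) * w' := by
      rw [hxw]
      simp only [map_mul, map_pow]
      ring
    rw [e]
    exact dvd_add (dvd_add (dvd_mul_right _ _) (dvd_mul_of_dvd_left d1 _)) (dvd_mul_of_dvd_left d2 _)

/-- **`([a] − p)` is a PRIME ideal of `W(𝒪)`** for `𝒪` a perfect valuation domain of characteristic `p` and `0 ≠ a` a non-unit that is
adically Hausdorff (`⋂ₙ (aⁿ) = 0`) — [FF18, §2.2] «`W(𝒪_F)/([a] − p)` is a domain» (the ring of integers of the untilt at `y_a`),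
here WITHOUT constructing the untilt: if `x·y ∈ ([a] − p)` with `x, y ∉ ([a] − p)`, then `x ≡ [c]u`, `y ≡ [c′]u′` give `[cc′]·uu′ ∈ ([a] − p)`,
hence `cc′ = 0` (`eq_zero_of_teichSubP_dvd_teichmuller`), contradicting `c, c′ ≠ 0`. [folklore] -/
theorem isPrime_span_teichSubP {a : O} (ha0 : a ≠ 0) (ha : ¬ IsUnit a)
    (hH : ∀ c : O, (∀ n : ℕ, a ^ n ∣ c) → c = 0) : (Ideal.span {teichSubP p a}).IsPrime := by
  refine Ideal.isPrime_iff.2 ⟨?_, fun {x y} hxy => ?_⟩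
  · rw [Ne, Ideal.span_singleton_eq_top]
    intro hu
    apply ha
    have h0 := hu.map (constantCoeff : WittVector p O →+* O)
    rwa [constantCoeff_apply, coeff_zero_teichSubP] at h0
  · simp only [Ideal.mem_span_singleton] at hxy ⊢
    by_contra h
    push Not at h
    obtain ⟨c, u, hc, hu, hdx⟩ := exists_teichmuller_mul_unit_of_not_dvd p ha0 h.1
    obtain ⟨c', u', hc', hu', hdy⟩ := exists_teichmuller_mul_unit_of_not_dvd p ha0 h.2
    have hprod : teichSubP p a ∣ teichmuller p (c * c') * (u * u') := by
      have e : teichmuller p (c * c') * (u * u') =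
          x * y - ((x - teichmuller p c * u) * y + teichmuller p c * u * (y - teichmuller p c' * u')) := by
        rw [map_mul]; ring
      rw [e]
      exact dvd_sub hxy (dvd_add (dvd_mul_of_dvd_left hdx _) (dvd_mul_of_dvd_right hdy _))
    exact mul_ne_zero hc hc' (eq_zero_of_teichSubP_dvd_teichmuller p hH ((hu.mul hu').dvd_mul_right.1 hprod))

/-- The quotient `W(𝒪)/([a] − p)` — the would-be ring of integers of the untilt `K_{y_a}` — **is an integral domain** (same hypotheses).
[folklore] -/
theorem isDomain_quotient_span_teichSubP {a : O} (ha0 : a ≠ 0) (ha : ¬ IsUnit a)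
    (hH : ∀ c : O, (∀ n : ℕ, a ^ n ∣ c) → c = 0) :
    IsDomain (WittVector p O ⧸ Ideal.span {teichSubP p a}) :=
  (Ideal.Quotient.isDomain_iff_prime _).2 (isPrime_span_teichSubP p ha0 ha hH)

/-- **[J-IIp] Prop. 6.2.1 (2) — `Witt.Prop621PrimeClaim` DISCHARGED**: over a perfect valuation domain `𝒪` of characteristic `p`, for
every PROPER ideal `𝔪` whose elements are adically Hausdorff (Joshi's `𝔪_F ⊂ 𝒪_F`, `F` perfectoid: rank one), every `ℓ⋆`, every
`0 ≠ a ∈ 𝔪` and every `j = 1, …, ℓ⋆`, the ideal `𝔭_j = ([a^{j²}] − p) ⊂ W(𝒪)` IS PRIME (p. 14 l. 57–59). The [FF18, Lem. 2.2.14] input of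
the printed proof (p. 15 l. 8–14) is replaced by the kernel argument above. [claim: Joshi2023ATS2Local, status: disputed] -/
theorem prop621PrimeClaim_of_valuationRing {𝔪 : Ideal O} (h𝔪 : 𝔪 ≠ ⊤)
    (hH : ∀ a ∈ 𝔪, ∀ c : O, (∀ n : ℕ, a ^ n ∣ c) → c = 0) (lstar : ℕ) : Prop621PrimeClaim p 𝔪 lstar := by
  intro a ha0 ha i
  rw [jIdeal, ansatzTuple]
  have hk : 0 < ((i : ℕ) + 1) ^ 2 := by positivity
  refine isPrime_span_teichSubP p (pow_ne_zero _ ha0)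
    (fun hu => h𝔪 (Ideal.eq_top_of_isUnit_mem 𝔪 (𝔪.pow_mem_of_mem ha _ hk) hu)) fun c hc => hH a ha c fun n => ?_
  exact (pow_dvd_pow a (Nat.le_mul_of_pos_left n hk)).trans (by rw [pow_mul]; exact hc n)

/-- **Prop. 6.2.1 (2) for the maximal ideal** `𝔪 = 𝔪_𝒪` of a perfect valuation domain in which every non-unit is adically Hausdorff
(= every rank-one `𝒪_F`): `Witt.Prop621PrimeClaim p (maximalIdeal 𝒪) ℓ⋆`. [claim: Joshi2023ATS2Local, status: disputed] -/
theorem prop621PrimeClaim_maximalIdeal (hH : ∀ a : O, ¬ IsUnit a → ∀ c : O, (∀ n : ℕ, a ^ n ∣ c) → c = 0) (lstar : ℕ) :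
    Prop621PrimeClaim p (IsLocalRing.maximalIdeal O) lstar :=
  prop621PrimeClaim_of_valuationRing p (IsLocalRing.maximalIdeal.isMaximal O).ne_top
    (fun a ha => hH a ((IsLocalRing.mem_maximalIdeal a).1 ha)) lstar

end Valuation

end Summit.ABC.IUTFork.Joshi.Witt

end
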